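import Summits.Parity.GeneralizedHardyLittlewood.Theorems.LeeYangFibresRelativeDimOnePairRigidityWeightedMain
import Summits.Parity.GeneralizedHardyLittlewood.Theorems.LeeYangFibresRelativeDimOnePairRigidityDecay
import HarnessLib

/-!
# Reshaped pair-slice rigidity, WEIGHTED form — part 3, ASSEMBLY (`pairRigidityWeighted`)

Context (seat c1, crux stmt-Parity-14113, line `gallagher-backwards-split`): the registered `stub_rigidity` is FALSE
(`Cruxes/RelativeDimOne/StubRigidityFalse-c1.md`); the reshaped pair-slice rigidity `pairRigidityWithDecay` (decay
`C/φ(d)`) is landed in `…PairRigidityDecay*.lean`.  The reshaped PAIR line needs the decay measured by a general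
Hardy–Littlewood weight `ρ` — e.g. `ρ(d) = Π_{p∣d} p/(p−1)²`, the divisor form of the twin singular-series spectrum,
for which `G_ρ(h) = Σ_{d∣h} ρ(d) ≍ h/φ(h) ≍ 𝔖(h)+1` but `ρ(d)` is NOT `O(1/φ(d))`.  This series (`…Weighted{Defs,Tools,Main,}`)
proves the WEIGHTED statement `pairRigidityWeighted` by the same elementary argument.

THE STATEMENT.  For every HL weight `ρ` (`IsHLWeight ρ c₀`) and `C, κ > 0` there are `η = κ/3`, `w₀`, `N₀` such that for
`N ≥ N₀`, every level `Q`, every `x` supported on squarefree `d ∈ [1,Q]` with `|x_d| ≤ C ρ(d)`: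
IF `|Φ_{ge}(r)| ≤ η·G_ρ(g)` at ALIGNED patterns (`g ⊥ e`, `e ∣ Π_{p≤w₀} p`, `ge ≤ N^{3/10}`, `g ∣ r`, `r ≡ 1 (e)`)
THEN `|Σ_{d ∣ h} x_d| ≤ κ·G_ρ(h)` for all `1 ≤ h ≤ N`.  Constants: `w₀ = ⌈6Cc₀/κ⌉+⌈c₀⌉+1`, `B = ⌈20c₀/ε₀⌉+1`,
`ε₀ = min(1, κ/6C)`, `N₀ = 4^{10(4^B+2w₀+2)}`; proof as in `pairRigidityWithDecay` with `c₀` carried through.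
-/

noncomputable section

open scoped BigOperators
open Finset Real

namespace Summit.Parity.GeneralizedHardyLittlewood.Cruxes.RelativeDimOne.RigidityC1

variable {ρ : ℕ → ℝ} {c₀ : ℝ}

/-! ### Assembly -/

set_option maxHeartbeats 400000 in
/-- **Reshaped pair rigidity, WEIGHTED form (general Hardy–Littlewood weight `ρ`).**
For every weight with `IsHLWeight ρ c₀` and every `C, κ > 0` there are `η = κ/3 > 0`, `w₀` and `N₀` such that for
all `N ≥ N₀`, every level `Q` and every spectrum `x` supported on squarefree `d ∈ [1, Q]` with decay
`|x_d| ≤ C·ρ(d)`: IF the density averages satisfy `|Φ_{ge}(r)| ≤ η · G_ρ(g)` at all ALIGNED patterns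
(`g ⊥ e`, `e ∣ Π_{p ≤ w₀} p`, `1 ≤ ge ≤ N^{3/10}`, `g ∣ r`, `r ≡ 1 (mod e)`), THEN `|Σ_{d ∣ h} x_d| ≤ κ · G_ρ(h)`
for every `1 ≤ h ≤ N`, `G_ρ(n) = Σ_{d ∣ n} ρ(d)`.  With `ρ(d) = Π_{p∣d} p/(p−1)²` (the divisor form of the twin
singular-series spectrum, `c₀ = 2`) the scale `G_ρ(h)` is `≍ h/φ(h) ≍ 𝔖(h)+1`: this is the shape the reshaped PAIR
line (`gallagher-backwards-split`, crux stmt-Parity-14113) consumes; see `Cruxes/RelativeDimOne/StubRigidityFalse-c1.md`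
§7–§9 and `pairRigidityWithDecay` (the case `ρ = 1/φ`). -/
theorem pairRigidityWeighted : ∀ (ρ : ℕ → ℝ) (c₀ C κ : ℝ), IsHLWeight ρ c₀ → 0 < C → 0 < κ →
    ∃ η : ℝ, 0 < η ∧ ∃ w₀ N₀ : ℕ, ∀ N : ℕ, N₀ ≤ N → ∀ Q : ℕ, ∀ x : ℕ → ℝ,
      (∀ d, x d ≠ 0 → Squarefree d ∧ 1 ≤ d ∧ d ≤ Q) → (∀ d, |x d| ≤ C * ρ d) →
      (∀ g e r : ℕ, Nat.Coprime g e → e ∣ primorial w₀ → 1 ≤ g * e →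
          ((g * e : ℕ) : ℝ) ≤ (N : ℝ) ^ ((3 : ℝ) / 10) → g ∣ r → r ≡ 1 [MOD e] →
          |densAvg Q x (g * e) r| ≤ η * wDivSum ρ g) →
      ∀ h : ℕ, 1 ≤ h → h ≤ N → |divSum x h| ≤ κ * wDivSum ρ h := by
  intro ρ c₀ C κ hρ hC hκ
  classical
  have hc₀1 : 1 ≤ c₀ := hρ.one_le
  have hc₀0 : 0 < c₀ := lt_of_lt_of_le one_pos hc₀1
  -- constants
  set ε₀ : ℝ := min 1 (κ / (6 * C)) with hε₀
  have hε₀pos : 0 < ε₀ := lt_min one_pos (by positivity)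
  have hε₀1 : ε₀ ≤ 1 := min_le_left _ _
  have hε₀2 : ε₀ ≤ κ / (6 * C) := min_le_right _ _
  set w₀ : ℕ := ⌈6 * C * c₀ / κ⌉₊ + ⌈c₀⌉₊ + 1 with hw₀
  have hw₀1 : 1 ≤ w₀ := by omega
  have hw₀ge : 6 * C * c₀ / κ ≤ w₀ := by
    rw [hw₀]; push_cast
    have h1 := Nat.le_ceil (6 * C * c₀ / κ)
    have h2 : (0 : ℝ) ≤ (⌈c₀⌉₊ : ℝ) := Nat.cast_nonneg _
    linarith
  have hcw : c₀ ≤ w₀ := by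
    rw [hw₀]; push_cast
    have h1 := Nat.le_ceil c₀
    have h2 : (0 : ℝ) ≤ (⌈6 * C * c₀ / κ⌉₊ : ℝ) := Nat.cast_nonneg _
    linarith
  set B : ℕ := ⌈20 * c₀ / ε₀⌉₊ + 1 with hB
  have hBge : 20 * c₀ / ε₀ ≤ B := by
    rw [hB]; push_cast
    exact (Nat.le_ceil _).trans (by linarith)
  have hB0 : (0 : ℝ) < B := lt_of_lt_of_le (by positivity) hBge
  set cB : ℕ := 4 ^ B with hcB
  have hcB1 : 1 ≤ cB := Nat.one_le_pow _ _ (by norm_num)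
  set K : ℕ := cB + 2 * w₀ + 2 with hK
  refine ⟨κ / 3, by positivity, w₀, 4 ^ (10 * K), ?_⟩
  intro N hN Q x hsupp hdec hA h hh1 hhN
  -- scale parameters
  have hN1 : 1 ≤ N := le_trans (Nat.one_le_pow _ _ (by norm_num)) hN
  have hN3 : N ^ 3 ≠ 0 := pow_ne_zero _ (by omega)
  have hNN3 : N ≤ N ^ 3 := Nat.le_self_pow (by norm_num) N
  set L := Nat.log 4 (N ^ 3) with hL
  set m := L / 10 with hm
  have hpowL : 4 ^ L ≤ N ^ 3 := Nat.pow_log_le_self 4 hN3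
  have hLlt : N ^ 3 < 4 ^ (L + 1) := Nat.lt_pow_succ_log_self (by norm_num) _
  have hmL : 10 * m ≤ L := by rw [hm]; omega
  have hLm : L + 1 ≤ 10 * (m + 1) := by rw [hm]; omega
  have hKL : 10 * K ≤ L := by
    rw [hL]
    exact Nat.le_log_of_pow_le (by norm_num) (hN.trans hNN3)
  have hKm : K ≤ m := by rw [hm]; omega
  set w' := m - w₀ with hw'
  have hmw : w' + w₀ = m := by rw [hw']; omega
  have hw'5 : cB + (w₀ + 2) ≤ w' := by rw [hw']; omega
  have hw'1 : w₀ + 1 ≤ w' := by omega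
  have hw'B : cB ≤ w' + 1 := by omega
  have hw'pos : 1 ≤ w' := by omega
  -- the radical of `h` and its prime sets
  have hh0 : h ≠ 0 := by omega
  set P := h.primeFactors with hP
  have hPprime : ∀ p ∈ P, p.Prime := fun p hp => Nat.prime_of_mem_primeFactors hp
  set P₁ := P.filter (· ≤ w') with hP₁
  set P₂ := P.filter (fun p => ¬ p ≤ w') with hP₂
  set h₁ := ∏ p ∈ P₁, p with hh₁
  set h₂ := ∏ p ∈ P₂, p with hh₂
  have hn : h₁ * h₂ = ∏ p ∈ P, p := Finset.prod_filter_mul_prod_filter_not P _ _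
  have hndvd : h₁ * h₂ ∣ h := by rw [hn]; exact Nat.prod_primeFactors_dvd h
  have hn0 : h₁ * h₂ ≠ 0 := fun h0 => hh0 (Nat.eq_zero_of_zero_dvd (h0 ▸ hndvd))
  have hh₁0 : h₁ ≠ 0 := left_ne_zero_of_mul hn0
  have hh₁dvd : h₁ ∣ h := (dvd_mul_right h₁ h₂).trans hndvd
  -- `F(h) = F(h₁ h₂)` (squarefree support)
  have hFrad : divSum x h = divSum x (h₁ * h₂) := by
    unfold divSum
    symm
    refine Finset.sum_subset (Nat.divisors_subset_of_dvd hh0 hndvd) ?_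
    intro d hd hdn
    by_contra hx
    apply hdn
    have hsq : Squarefree d := (hsupp d hx).1
    have hdh : d ∣ h := Nat.dvd_of_mem_divisors hd
    rw [Nat.mem_divisors]
    refine ⟨?_, hn0⟩
    rw [hn, ← Nat.prod_primeFactors_of_squarefree hsq]
    exact Finset.prod_dvd_prod_of_subset _ _ _ (Nat.primeFactors_mono hdh hh0)
  -- TAIL
  have htail : |divSum x (h₁ * h₂) - divSum x h₁| ≤ κ / 3 * wDivSum ρ h := by
    have ht := abs_divSum_prod_sub_weighted_le hρ hdec P hPprime w'
    have hG₂ : wDivSum ρ h₂ ≤ Real.exp (c₀ * (P₂.card : ℝ) / w') := by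
      refine wDivSum_prod_large_primes_le hρ P₂ (fun p hp => hPprime p (Finset.mem_filter.1 hp).1)
        hw'pos ?_
      intro p hp
      have := (Finset.mem_filter.1 hp).2
      omega
    -- `k / w' ≤ ε₀`
    set k := P₂.card with hk
    have hprod : (w' + 1) ^ k ≤ N := by
      have h1 : (w' + 1) ^ k ≤ h₂ := by
        rw [hh₂, hk]
        refine Finset.pow_card_le_prod P₂ (fun p => p) (w' + 1) fun p hp => ?_
        have := (Finset.mem_filter.1 hp).2
        omega
      have h2 : h₂ ≤ h := Nat.le_of_dvd (by omega) ((dvd_mul_left h₂ h₁).trans hndvd)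
      exact h1.trans (h2.trans hhN)
    have hBk : B * k < 20 * w' := by
      have h1 : 4 ^ (B * k) ≤ N := by
        rw [pow_mul, ← hcB]
        exact (Nat.pow_le_pow_left hw'B k).trans hprod
      have h2 : 4 ^ (B * k) < 4 ^ (L + 1) := lt_of_le_of_lt (h1.trans hNN3) hLlt
      have h3 : B * k < L + 1 := (Nat.pow_lt_pow_iff_right (by norm_num)).1 h2
      have h4 : L + 1 ≤ 10 * (w' + w₀ + 1) := by rw [hmw]; exact hLm
      omega
    have hy : c₀ * (k : ℝ) / w' ≤ ε₀ := by
      have hw'0 : (0 : ℝ) < w' := by exact_mod_cast hw'pos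
      have h1 : (B : ℝ) * k < 20 * w' := by exact_mod_cast hBk
      rw [div_le_iff₀ hw'0]
      -- `c₀ k ≤ 20 c₀ w'/B ≤ ε₀ w'`
      have h2 : c₀ * (k : ℝ) * B ≤ 20 * c₀ * w' := by nlinarith [h1.le, hc₀0.le]
      have h3 : (20 : ℝ) * c₀ ≤ ε₀ * B := by
        have := (div_le_iff₀ hε₀pos).1 hBge
        linarith
      have hw'nn : (0 : ℝ) ≤ w' := hw'0.le
      have h4 : (20 : ℝ) * c₀ * w' ≤ ε₀ * B * w' := mul_le_mul_of_nonneg_right h3 hw'nn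
      have h5 : (c₀ * (k : ℝ)) * B ≤ (ε₀ * w') * B := by nlinarith [h2, h4]
      exact le_of_mul_le_mul_right h5 hB0
    have hy0 : (0 : ℝ) ≤ c₀ * (k : ℝ) / w' := by positivity
    have hexp : Real.exp (c₀ * (k : ℝ) / w') - 1 ≤ 2 * (c₀ * (k : ℝ) / w') := by
      have habs : |c₀ * (k : ℝ) / w'| ≤ 1 := by rw [abs_of_nonneg hy0]; exact hy.trans hε₀1
      have h1 := Real.abs_exp_sub_one_le habs
      rw [abs_of_nonneg hy0] at h1
      exact (le_abs_self _).trans h1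
    have hG₁le : wDivSum ρ h₁ ≤ wDivSum ρ h := wDivSum_mono hρ hh₁dvd hh0
    have hG₁0 : 0 ≤ wDivSum ρ h₁ := wDivSum_nonneg hρ _
    have hGh0 : 0 ≤ wDivSum ρ h := wDivSum_nonneg hρ _
    calc |divSum x (h₁ * h₂) - divSum x h₁|
        ≤ C * wDivSum ρ h₁ * (wDivSum ρ h₂ - 1) := ht
      _ ≤ C * wDivSum ρ h * (2 * (c₀ * (k : ℝ) / w')) := by
          have hG₂' : wDivSum ρ h₂ - 1 ≤ 2 * (c₀ * (k : ℝ) / w') := by linarith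
          have h12 : 0 ≤ wDivSum ρ h₂ - 1 := by
            have := one_le_wDivSum hρ (n := h₂) (right_ne_zero_of_mul hn0)
            linarith
          calc C * wDivSum ρ h₁ * (wDivSum ρ h₂ - 1) ≤ C * wDivSum ρ h * (wDivSum ρ h₂ - 1) := by
                gcongr
            _ ≤ C * wDivSum ρ h * (2 * (c₀ * (k : ℝ) / w')) := by gcongr
      _ ≤ C * wDivSum ρ h * (2 * ε₀) := by gcongr
      _ ≤ κ / 3 * wDivSum ρ h := by
          have : C * (2 * ε₀) ≤ κ / 3 := by
            have h1 : C * (2 * ε₀) ≤ C * (2 * (κ / (6 * C))) := by gcongr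
            have h2 : C * (2 * (κ / (6 * C))) = κ / 3 := by field_simp; ring
            linarith
          calc C * wDivSum ρ h * (2 * ε₀) = (C * (2 * ε₀)) * wDivSum ρ h := by ring
            _ ≤ κ / 3 * wDivSum ρ h := mul_le_mul_of_nonneg_right this hGh0
  -- MAIN TERM
  set P' := ∏ p ∈ ((Finset.range (w₀ + 1)).filter Nat.Prime).filter (fun p => ¬ p ∣ h), p with hP'
  have hP'pos : 0 < P' :=
    Finset.prod_pos fun p hp => (Finset.mem_filter.1 (Finset.mem_filter.1 hp).1).2.pos
  have hcopq : Nat.Coprime h₁ P' := by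
    rw [hh₁, hP']
    refine Nat.Coprime.prod_left fun p hp => Nat.Coprime.prod_right fun q hq => ?_
    have hp' := Finset.mem_filter.1 hp
    have hq' := Finset.mem_filter.1 hq
    have hqq := Finset.mem_filter.1 hq'.1
    have hpdvd : p ∣ h := Nat.dvd_of_mem_primeFactors hp'.1
    have hne : p ≠ q := fun e => hq'.2 (e ▸ hpdvd)
    exact (Nat.coprime_primes (hPprime p hp'.1) hqq.2).2 hne
  have hcover : ∀ p : ℕ, p.Prime → p ≤ w₀ → p ∣ h₁ * P' := by
    intro p hp hpw
    by_cases hph : p ∣ h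
    · have hpP₁ : p ∈ P₁ := by
        rw [hP₁, Finset.mem_filter, hP]
        exact ⟨Nat.mem_primeFactors.2 ⟨hp, hph, hh0⟩, by omega⟩
      have h1 : p ∣ h₁ := by rw [hh₁]; exact Finset.dvd_prod_of_mem _ hpP₁
      exact dvd_mul_of_dvd_left h1 P'
    · have hpP' : p ∈ ((Finset.range (w₀ + 1)).filter Nat.Prime).filter (fun p => ¬ p ∣ h) := by
        rw [Finset.mem_filter, Finset.mem_filter, Finset.mem_range]
        exact ⟨⟨by omega, hp⟩, hph⟩
      have h1 : p ∣ P' := by rw [hP']; exact Finset.dvd_prod_of_mem _ hpP'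
      exact dvd_mul_of_dvd_right h1 h₁
  obtain ⟨r, hr⟩ := Nat.chineseRemainder hcopq 0 1
  have hr1 : h₁ ∣ r := (Nat.modEq_zero_iff_dvd.1 hr.1)
  -- size of `q = h₁ P'`
  have hP'dvd : P' ∣ primorial w₀ := by
    rw [hP', primorial]
    exact Finset.prod_dvd_prod_of_subset _ _ _ (Finset.filter_subset _ _)
  have hq10 : (h₁ * P') ^ 10 ≤ N ^ 3 := by
    have h1 : h₁ ∣ primorial w' := by
      rw [hh₁, primorial]
      refine Finset.prod_dvd_prod_of_subset _ _ _ fun p hp => ?_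
      have hp' := Finset.mem_filter.1 hp
      rw [Finset.mem_filter, Finset.mem_range]
      exact ⟨by omega, hPprime p hp'.1⟩
    have h2 : P' ∣ primorial w₀ := hP'dvd
    have h3 : h₁ ≤ 4 ^ w' := (Nat.le_of_dvd (primorial_pos _) h1).trans (primorial_le_four_pow _)
    have h4 : P' ≤ 4 ^ w₀ := (Nat.le_of_dvd (primorial_pos _) h2).trans (primorial_le_four_pow _)
    have h5 : h₁ * P' ≤ 4 ^ m := by
      calc h₁ * P' ≤ 4 ^ w' * 4 ^ w₀ := Nat.mul_le_mul h3 h4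
        _ = 4 ^ m := by rw [← pow_add, hmw]
    calc (h₁ * P') ^ 10 ≤ (4 ^ m) ^ 10 := Nat.pow_le_pow_left h5 10
      _ = 4 ^ (10 * m) := by rw [← pow_mul, mul_comm]
      _ ≤ 4 ^ L := Nat.pow_le_pow_right (by norm_num) hmL
      _ ≤ N ^ 3 := hpowL
  have hqreal : ((h₁ * P' : ℕ) : ℝ) ≤ (N : ℝ) ^ ((3 : ℝ) / 10) := le_rpow_of_pow_le hq10
  have hq1 : 1 ≤ h₁ * P' := Nat.one_le_iff_ne_zero.2 (mul_ne_zero hh₁0 hP'pos.ne')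
  have hAq := hA h₁ P' r hcopq hP'dvd hq1 hqreal hr1 hr.2
  have hmain := abs_densAvg_sub_divSum_weighted_le hρ (Q := Q) hC.le hw₀1 hcw hh₁0 hcopq hr1 hr.2
    hcover hsupp hdec
  -- `|F(h₁)| ≤ (2κ/3) G(h)`
  have hG₁le : wDivSum ρ h₁ ≤ wDivSum ρ h := wDivSum_mono hρ hh₁dvd hh0
  have hG₁0 : 0 ≤ wDivSum ρ h₁ := wDivSum_nonneg hρ _
  have hF₁ : |divSum x h₁| ≤ 2 * (κ / 3) * wDivSum ρ h := by
    have h1 : |divSum x h₁| ≤ |densAvg Q x (h₁ * P') r| + |densAvg Q x (h₁ * P') r - divSum x h₁| := by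
      have := abs_sub (densAvg Q x (h₁ * P') r) (densAvg Q x (h₁ * P') r - divSum x h₁)
      rwa [sub_sub_cancel] at this
    have h2 : C * wDivSum ρ h₁ * (2 * c₀ / w₀) ≤ κ / 3 * wDivSum ρ h₁ := by
      have hw₀0 : (0 : ℝ) < w₀ := by exact_mod_cast hw₀1
      have h6 : 6 * C * c₀ ≤ (w₀ : ℝ) * κ := (div_le_iff₀ hκ).1 hw₀ge
      have : C * (2 * c₀ / w₀) ≤ κ / 3 := by
        rw [mul_div_assoc', div_le_iff₀ hw₀0]
        linarith
      calc C * wDivSum ρ h₁ * (2 * c₀ / w₀) = (C * (2 * c₀ / w₀)) * wDivSum ρ h₁ := by ring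
        _ ≤ κ / 3 * wDivSum ρ h₁ := mul_le_mul_of_nonneg_right this hG₁0
    have h3 : κ / 3 * wDivSum ρ h₁ ≤ κ / 3 * wDivSum ρ h :=
      mul_le_mul_of_nonneg_left hG₁le (by positivity)
    linarith
  -- combine
  rw [hFrad]
  have hsplit : |divSum x (h₁ * h₂)| ≤ |divSum x (h₁ * h₂) - divSum x h₁| + |divSum x h₁| := by
    have := abs_add_le (divSum x (h₁ * h₂) - divSum x h₁) (divSum x h₁)
    rwa [sub_add_cancel] at this
  linarith


end Summit.Parity.GeneralizedHardyLittlewood.Cruxes.RelativeDimOne.RigidityC1
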